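import Summits.Ventures.PercRepro.RankLevelSetLevelSixHeavyCellSq36Q
import Summits.Ventures.PercRepro.RankLevelSetLevelSixArithHeavySq36QA
import Summits.Ventures.PercRepro.RankLevelSetLevelSixArithHeavySq36QB
import Summits.Ventures.PercRepro.RankLevelSetLevelSixArithHeavySq36QC
import Summits.Ventures.PercRepro.RankLevelSetLevelSixArithHeavySq36QD
import Summits.Ventures.PercRepro.RankLevelSetLevelSixArithHeavySq36QE
import Summits.Ventures.PercRepro.RankLevelSetLevelSixArithHeavySq36QF
import Summits.Ventures.PercRepro.RankLevelSetLevelSixArithHeavySq36QG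
import Summits.Ventures.PercRepro.RankLevelSetLevelSixArithHeavySq36QH
import Summits.Ventures.PercRepro.RankLevelSetLevelSixArithHeavySq36QI
import Summits.Ventures.PercRepro.S3SixWindow
import Summits.Ventures.PercRepro.RankLevelSetCoreSixLowSelfB
import Summits.Ventures.PercRepro.RankLevelSetLevelFivePart

/-!
# PercRepro — THEOREM C₆ ON THE FLAT BOUNDS `f(6) ≤ 39`, `f(5) ≤ 19`, LEMMA Q / T⁺⁺⁺, THE 4-CIRCUIT TABLE, THE FLAT-COUNT TAIL
AND THE UNIQUE HEAVY FLAT: LEVEL `5` AT `35` ⇒ C-025 AT LEVEL `6` FOR EVERY `p ≥ 36`, AND `c025_six_large_thirty_six (36 ≤ p) : RLS M p 6`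
UNCONDITIONAL (p8 g3, S3)

`proofs/SUBCLAIM-S3-p8.md` §3n. The 37 chain of §3m (`c025_six_large_thirty_seven`) with p2's LEMMA Q (`s₃ ≤ cq d`,
`S1.core_ncard_triangles_le_cq`, S1TriangleQ: `16 · 20 · 36` at `d = 8, 9, 12` — the three cells that stop the 37 chain at `36`)
for `s₃` at `d ≤ 12` (LEMMA T⁺⁺⁺ beyond), the 4-circuit table for `s₄`; the levers otherwise as in §3k: THE UNIQUE HEAVY FLAT (RankLevelSetDepCountHeavyU:
when `2ν₁ ≥ d + 15` two heavy rank-`6` flats would meet in a rank-`≤ 5` set of nullity `> 14`, so `|UG| ≤ min(39, 6 + d)` in place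
of the union bound `6 + (j + 1)d − jν₁` — `2^{39}` against `2^{55}` at `(39, 41)`); the other levers as in §3i: p1's LEMMA T⁺⁺
(`s₃ ≤ (d² − 3d + 8)/2`, S1TrianglePlusPlus) and the FLAT-COUNT TAIL (the rank-`≤ 6` sets `≤ Σ_{j ≤ 19} C(n, j) +
2^{33}·Σ_{j ≤ 6} C(n, j)`, coranks 24 … 51). Every core cell `(p, 7 ≤ d ≤ 50)` at `p ≥ 36` by the split cell
`c025_core_six_heavy_cell_sq39u` (the unique flat from `d = 30`; no heavy-free cell is needed), with the per-corank parameters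
of RankLevelSetLevelSixArithHeavySq36QA … I (`c025_core_six_bounded_corank_heavy_sq36q`); the cells `d ≥ 52` by `c025_core_six_thirtynine_thirtysix'`
(`37 ≤ p`, RankLevelSetCoreSixLowSelfB: the corank key at `36` holds from `n₀ = 88 = p + 52`, so the cell `(36, 51)` is a bounded-corank cell here); level `5` for `p ≥ 35` gives level `6` for `p ≥ 36` (`c025_six_of_five_heavy_sq36q`: rank `36` by
`rls_six_at_of_core`, ranks `≥ 37` by `rls_succ_large`). On p7's `c025_five_large_part33 (33 ≤ p)` (RankLevelSetLevelFivePart)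
this is **`c025_six_large_thirty_six (36 ≤ p)`**, unconditional over the tree. At `35` the cells `d = 8, 14, 24` fail (`s₃ ≤ 15` needed at `d = 8` against `cq 8 = 16`; the `s₃` bound at `14`;
the `s₄`, `s₅` terms against the tail room at `24`). Axioms: standard.
-/

open scoped Matroid

namespace PercRepro

namespace ThmN

open Set

variable {α : Type}

/-- **The `e`-free core at level `6`, corank `7 ≤ d ≤ 51`, rank `p ≥ 36`** (flat bounds `39 / 19`, LEMMA T⁺⁺, square
multiplicity, rational tails in the nullity-cap or the flat-count form, the unique heavy flat from `d = 30`, LEMMA Q / T⁺⁺⁺ and the 4-circuit table). -/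
theorem c025_core_six_bounded_corank_heavy_sq36q (M : Matroid α) [M.Finite] (p d : ℕ) (hp : 36 ≤ p) (hd7 : 7 ≤ d)
    (hd51 : d ≤ 51) (hR : M.eRank = (p : ℕ∞)) (hn : M.E.ncard = p + d)
    (hfree : ∀ e ∈ M.E, ∃ A ⊆ M.E \ {e}, e ∉ M.closure A ∧ e ∉ M.closure ((M.E \ {e}) \ A)) :
    RLS M p 6 := by
  interval_cases d
  · exact c025_core_six_heavy_cell_sq36q M p 7 7 1 1 13 12 0 145696 1000 13 118 13
      (by norm_num) (by norm_num) (by norm_num) (by norm_num) (by norm_num) (by norm_num) (by norm_num)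
      (by norm_num [cnull]) (by norm_num [cnull]) (Or.inl (by norm_num)) (Or.inl (by norm_num)) (Or.inl (by norm_num)) (by norm_num) (by norm_num) (by norm_num) (by decide) (Or.inl (by decide))
      (Or.inl (tail_six_heavy_sq36Q_7 (p + 7) (by omega))) hR hn hfree (level_six_poly_heavy_sq36Q_7 p hp)
  · exact c025_core_six_heavy_cell_sq36q M p 8 7 2 1 16 14 0 88283 1000 14 170 16
      (by norm_num) (by norm_num) (by norm_num) (by norm_num) (by norm_num) (by norm_num) (by norm_num)
      (by norm_num [cnull]) (by norm_num [cnull]) (Or.inl (by norm_num)) (Or.inl (by norm_num)) (Or.inl (by norm_num)) (by norm_num) (by norm_num) (by norm_num) (by decide) (Or.inl (by decide))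
      (Or.inl (tail_six_heavy_sq36Q_8 (p + 8) (by omega))) hR hn hfree (level_six_poly_heavy_sq36Q_8 p hp)
  · exact c025_core_six_heavy_cell_sq36q M p 9 7 2 1 19 16 0 55922 1000 15 235 20
      (by norm_num) (by norm_num) (by norm_num) (by norm_num) (by norm_num) (by norm_num) (by norm_num)
      (by norm_num [cnull]) (by norm_num [cnull]) (Or.inl (by norm_num)) (Or.inl (by norm_num)) (Or.inl (by norm_num)) (by norm_num) (by norm_num) (by norm_num) (by decide) (Or.inl (by decide))
      (Or.inl (tail_six_heavy_sq36Q_9 (p + 9) (by omega))) hR hn hfree (level_six_poly_heavy_sq36Q_9 p hp)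
  · exact c025_core_six_heavy_cell_sq36q M p 10 7 2 1 22 18 0 36878 1000 16 315 25
      (by norm_num) (by norm_num) (by norm_num) (by norm_num) (by norm_num) (by norm_num) (by norm_num)
      (by norm_num [cnull]) (by norm_num [cnull]) (Or.inl (by norm_num)) (Or.inl (by norm_num)) (Or.inl (by norm_num)) (by norm_num) (by norm_num) (by norm_num) (by decide) (Or.inl (by decide))
      (Or.inl (tail_six_heavy_sq36Q_10 (p + 10) (by omega))) hR hn hfree (level_six_poly_heavy_sq36Q_10 p hp)
  · exact c025_core_six_heavy_cell_sq36q M p 11 8 2 1 23 19 0 25224 1000 17 411 30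
      (by norm_num) (by norm_num) (by norm_num) (by norm_num) (by norm_num) (by norm_num) (by norm_num)
      (by norm_num [cnull]) (by norm_num [cnull]) (Or.inl (by norm_num)) (Or.inl (by norm_num)) (Or.inl (by norm_num)) (by norm_num) (by norm_num) (by norm_num) (by decide) (Or.inl (by decide))
      (Or.inl (tail_six_heavy_sq36Q_11 (p + 11) (by omega))) hR hn hfree (level_six_poly_heavy_sq36Q_11 p hp)
  · exact c025_core_six_heavy_cell_sq36q M p 12 9 2 1 24 20 0 17838 1000 18 525 36
      (by norm_num) (by norm_num) (by norm_num) (by norm_num) (by norm_num) (by norm_num) (by norm_num)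
      (by norm_num [cnull]) (by norm_num [cnull]) (Or.inl (by norm_num)) (Or.inl (by norm_num)) (Or.inl (by norm_num)) (by norm_num) (by norm_num) (by norm_num) (by decide) (Or.inl (by decide))
      (Or.inl (tail_six_heavy_sq36Q_12 (p + 12) (by omega))) hR hn hfree (level_six_poly_heavy_sq36Q_12 p hp)
  · exact c025_core_six_heavy_cell_sq36q M p 13 10 1 1 22 18 0 13003 1000 19 658 68
      (by norm_num) (by norm_num) (by norm_num) (by norm_num) (by norm_num) (by norm_num) (by norm_num)
      (by norm_num [cnull]) (by norm_num [cnull]) (Or.inl (by norm_num)) (Or.inr (Or.inl ⟨by norm_num, by norm_num⟩)) (Or.inl (by norm_num)) (by norm_num) (by norm_num) (by norm_num) (by decide) (Or.inr (by norm_num))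
      (Or.inl (tail_six_heavy_sq36Q_13 (p + 13) (by omega))) hR hn hfree (level_six_poly_heavy_sq36Q_13 p hp)
  · exact c025_core_six_heavy_cell_sq36q M p 14 11 1 1 23 19 0 9744 1000 20 812 80
      (by norm_num) (by norm_num) (by norm_num) (by norm_num) (by norm_num) (by norm_num) (by norm_num)
      (by norm_num [cnull]) (by norm_num [cnull]) (Or.inl (by norm_num)) (Or.inr (Or.inl ⟨by norm_num, by norm_num⟩)) (Or.inl (by norm_num)) (by norm_num) (by norm_num) (by norm_num) (by decide) (Or.inr (by norm_num))
      (Or.inl (tail_six_heavy_sq36Q_14 (p + 14) (by omega))) hR hn hfree (level_six_poly_heavy_sq36Q_14 p hp)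
  · exact c025_core_six_heavy_cell_sq36q M p 15 11 1 1 25 19 0 7489 1000 21 988 93
      (by norm_num) (by norm_num) (by norm_num) (by norm_num) (by norm_num) (by norm_num) (by norm_num)
      (by norm_num [cnull]) (by norm_num [cnull]) (Or.inl (by norm_num)) (Or.inr (Or.inl ⟨by norm_num, by norm_num⟩)) (Or.inl (by norm_num)) (by norm_num) (by norm_num) (by norm_num) (by decide) (Or.inr (by norm_num))
      (Or.inl (tail_six_heavy_sq36Q_15 (p + 15) (by omega))) hR hn hfree (level_six_poly_heavy_sq36Q_15 p hp)
  · exact c025_core_six_heavy_cell_sq36q M p 16 12 1 1 26 19 0 5890 1000 22 1188 107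
      (by norm_num) (by norm_num) (by norm_num) (by norm_num) (by norm_num) (by norm_num) (by norm_num)
      (by norm_num [cnull]) (by norm_num [cnull]) (Or.inl (by norm_num)) (Or.inr (Or.inl ⟨by norm_num, by norm_num⟩)) (Or.inl (by norm_num)) (by norm_num) (by norm_num) (by norm_num) (by decide) (Or.inr (by norm_num))
      (Or.inl (tail_six_heavy_sq36Q_16 (p + 16) (by omega))) hR hn hfree (level_six_poly_heavy_sq36Q_16 p hp)
  · exact c025_core_six_heavy_cell_sq36q M p 17 12 1 1 28 19 0 4730 1000 23 1413 122
      (by norm_num) (by norm_num) (by norm_num) (by norm_num) (by norm_num) (by norm_num) (by norm_num)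
      (by norm_num [cnull]) (by norm_num [cnull]) (Or.inl (by norm_num)) (Or.inr (Or.inl ⟨by norm_num, by norm_num⟩)) (Or.inl (by norm_num)) (by norm_num) (by norm_num) (by norm_num) (by decide) (Or.inr (by norm_num))
      (Or.inl (tail_six_heavy_sq36Q_17 (p + 17) (by omega))) hR hn hfree (level_six_poly_heavy_sq36Q_17 p hp)
  · exact c025_core_six_heavy_cell_sq36q M p 18 13 1 1 29 19 0 3872 1000 24 1665 138
      (by norm_num) (by norm_num) (by norm_num) (by norm_num) (by norm_num) (by norm_num) (by norm_num)
      (by norm_num [cnull]) (by norm_num [cnull]) (Or.inl (by norm_num)) (Or.inr (Or.inl ⟨by norm_num, by norm_num⟩)) (Or.inl (by norm_num)) (by norm_num) (by norm_num) (by norm_num) (by decide) (Or.inr (by norm_num))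
      (Or.inl (tail_six_heavy_sq36Q_18 (p + 18) (by omega))) hR hn hfree (level_six_poly_heavy_sq36Q_18 p hp)
  · exact c025_core_six_heavy_cell_sq36q M p 19 13 1 1 31 19 0 3225 1000 25 1945 155
      (by norm_num) (by norm_num) (by norm_num) (by norm_num) (by norm_num) (by norm_num) (by norm_num)
      (by norm_num [cnull]) (by norm_num [cnull]) (Or.inl (by norm_num)) (Or.inr (Or.inl ⟨by norm_num, by norm_num⟩)) (Or.inl (by norm_num)) (by norm_num) (by norm_num) (by norm_num) (by decide) (Or.inr (by norm_num))
      (Or.inl (tail_six_heavy_sq36Q_19 (p + 19) (by omega))) hR hn hfree (level_six_poly_heavy_sq36Q_19 p hp)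
  · exact c025_core_six_heavy_cell_sq36q M p 20 14 1 1 32 19 0 2728 1000 26 2255 173
      (by norm_num) (by norm_num) (by norm_num) (by norm_num) (by norm_num) (by norm_num) (by norm_num)
      (by norm_num [cnull]) (by norm_num [cnull]) (Or.inl (by norm_num)) (Or.inr (Or.inl ⟨by norm_num, by norm_num⟩)) (Or.inl (by norm_num)) (by norm_num) (by norm_num) (by norm_num) (by decide) (Or.inr (by norm_num))
      (Or.inl (tail_six_heavy_sq36Q_20 (p + 20) (by omega))) hR hn hfree (level_six_poly_heavy_sq36Q_20 p hp)
  · exact c025_core_six_heavy_cell_sq36q M p 21 14 1 1 34 19 0 2341 1000 27 2596 192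
      (by norm_num) (by norm_num) (by norm_num) (by norm_num) (by norm_num) (by norm_num) (by norm_num)
      (by norm_num [cnull]) (by norm_num [cnull]) (Or.inl (by norm_num)) (Or.inr (Or.inl ⟨by norm_num, by norm_num⟩)) (Or.inl (by norm_num)) (by norm_num) (by norm_num) (by norm_num) (by decide) (Or.inr (by norm_num))
      (Or.inl (tail_six_heavy_sq36Q_21 (p + 21) (by omega))) hR hn hfree (level_six_poly_heavy_sq36Q_21 p hp)
  · exact c025_core_six_heavy_cell_sq36q M p 22 15 1 1 35 0 0 2035 1000 28 2970 212
      (by norm_num) (by norm_num) (by norm_num) (by norm_num) (by norm_num) (by norm_num) (by norm_num)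
      (by norm_num [cnull]) (by norm_num [cnull]) (Or.inl (by norm_num)) (Or.inr (Or.inr (by norm_num))) (Or.inl (by norm_num)) (by norm_num) (by norm_num) (by norm_num) (by decide) (Or.inr (by norm_num))
      (Or.inl (tail_six_heavy_sq36Q_22 (p + 22) (by omega))) hR hn hfree (level_six_poly_heavy_sq36Q_22 p hp)
  · exact c025_core_six_heavy_cell_sq36q M p 23 15 1 1 37 0 0 1789 1000 29 3378 233
      (by norm_num) (by norm_num) (by norm_num) (by norm_num) (by norm_num) (by norm_num) (by norm_num)
      (by norm_num [cnull]) (by norm_num [cnull]) (Or.inl (by norm_num)) (Or.inr (Or.inr (by norm_num))) (Or.inl (by norm_num)) (by norm_num) (by norm_num) (by norm_num) (by decide) (Or.inr (by norm_num))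
      (Or.inl (tail_six_heavy_sq36Q_23 (p + 23) (by omega))) hR hn hfree (level_six_poly_heavy_sq36Q_23 p hp)
  · exact c025_core_six_heavy_cell_sq36q M p 24 17 1 1 37 0 1 2007 1000 30 3822 255
      (by norm_num) (by norm_num) (by norm_num) (by norm_num) (by norm_num) (by norm_num) (by norm_num)
      (by norm_num [cnull]) (by norm_num [cnull]) (Or.inl (by norm_num)) (Or.inr (Or.inr (by norm_num))) (Or.inr rfl) (by norm_num) (by norm_num) (by norm_num) (by decide) (Or.inr (by norm_num))
      (Or.inr (tail_six_heavy_sq36Q_24 (p + 24) (by omega))) hR hn hfree (level_six_poly_heavy_sq36Q_24 p hp)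
  · exact c025_core_six_heavy_cell_sq36q M p 25 18 1 1 38 0 1 3000 1000 31 4303 278
      (by norm_num) (by norm_num) (by norm_num) (by norm_num) (by norm_num) (by norm_num) (by norm_num)
      (by norm_num [cnull]) (by norm_num [cnull]) (Or.inl (by norm_num)) (Or.inr (Or.inr (by norm_num))) (Or.inr rfl) (by norm_num) (by norm_num) (by norm_num) (by decide) (Or.inr (by norm_num))
      (Or.inr (tail_six_heavy_sq36Q_25 (p + 25) (by omega))) hR hn hfree (level_six_poly_heavy_sq36Q_25 p hp)
  · exact c025_core_six_heavy_cell_sq36q M p 26 19 1 1 39 0 1 3911 1000 32 4823 302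
      (by norm_num) (by norm_num) (by norm_num) (by norm_num) (by norm_num) (by norm_num) (by norm_num)
      (by norm_num [cnull]) (by norm_num [cnull]) (Or.inl (by norm_num)) (Or.inr (Or.inr (by norm_num))) (Or.inr rfl) (by norm_num) (by norm_num) (by norm_num) (by decide) (Or.inr (by norm_num))
      (Or.inr (tail_six_heavy_sq36Q_26 (p + 26) (by omega))) hR hn hfree (level_six_poly_heavy_sq36Q_26 p hp)
  · exact c025_core_six_heavy_cell_sq36q M p 27 20 1 1 40 0 1 4380 1000 33 5383 327
      (by norm_num) (by norm_num) (by norm_num) (by norm_num) (by norm_num) (by norm_num) (by norm_num)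
      (by norm_num [cnull]) (by norm_num [cnull]) (Or.inl (by norm_num)) (Or.inr (Or.inr (by norm_num))) (Or.inr rfl) (by norm_num) (by norm_num) (by norm_num) (by decide) (Or.inr (by norm_num))
      (Or.inr (tail_six_heavy_sq36Q_27 (p + 27) (by omega))) hR hn hfree (level_six_poly_heavy_sq36Q_27 p hp)
  · exact c025_core_six_heavy_cell_sq36q M p 28 20 1 1 42 0 1 4339 1000 34 5985 353
      (by norm_num) (by norm_num) (by norm_num) (by norm_num) (by norm_num) (by norm_num) (by norm_num)
      (by norm_num [cnull]) (by norm_num [cnull]) (Or.inl (by norm_num)) (Or.inr (Or.inr (by norm_num))) (Or.inr rfl) (by norm_num) (by norm_num) (by norm_num) (by decide) (Or.inr (by norm_num))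
      (Or.inr (tail_six_heavy_sq36Q_28 (p + 28) (by omega))) hR hn hfree (level_six_poly_heavy_sq36Q_28 p hp)
  · exact c025_core_six_heavy_cell_sq36q M p 29 22 1 1 35 0 1 3993 1000 35 6630 380
      (by norm_num) (by norm_num) (by norm_num) (by norm_num) (by norm_num) (by norm_num) (by norm_num)
      (by norm_num [cnull]) (by norm_num [cnull]) (Or.inr ⟨by norm_num, by norm_num⟩) (Or.inr (Or.inr (by norm_num))) (Or.inr rfl) (by norm_num) (by norm_num) (by norm_num) (by decide) (Or.inr (by norm_num))
      (Or.inr (tail_six_heavy_sq36Q_29 (p + 29) (by omega))) hR hn hfree (level_six_poly_heavy_sq36Q_29 p hp)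
  · exact c025_core_six_heavy_cell_sq36q M p 30 23 1 1 36 0 1 3553 1000 36 7320 408
      (by norm_num) (by norm_num) (by norm_num) (by norm_num) (by norm_num) (by norm_num) (by norm_num)
      (by norm_num [cnull]) (by norm_num [cnull]) (Or.inr ⟨by norm_num, by norm_num⟩) (Or.inr (Or.inr (by norm_num))) (Or.inr rfl) (by norm_num) (by norm_num) (by norm_num) (by decide) (Or.inr (by norm_num))
      (Or.inr (tail_six_heavy_sq36Q_30 (p + 30) (by omega))) hR hn hfree (level_six_poly_heavy_sq36Q_30 p hp)
  · exact c025_core_six_heavy_cell_sq36q M p 31 23 1 1 37 0 1 3131 1000 37 8056 437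
      (by norm_num) (by norm_num) (by norm_num) (by norm_num) (by norm_num) (by norm_num) (by norm_num)
      (by norm_num [cnull]) (by norm_num [cnull]) (Or.inr ⟨by norm_num, by norm_num⟩) (Or.inr (Or.inr (by norm_num))) (Or.inr rfl) (by norm_num) (by norm_num) (by norm_num) (by decide) (Or.inr (by norm_num))
      (Or.inr (tail_six_heavy_sq36Q_31 (p + 31) (by omega))) hR hn hfree (level_six_poly_heavy_sq36Q_31 p hp)
  · exact c025_core_six_heavy_cell_sq36q M p 32 24 1 1 38 0 1 2763 1000 38 8840 467
      (by norm_num) (by norm_num) (by norm_num) (by norm_num) (by norm_num) (by norm_num) (by norm_num)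
      (by norm_num [cnull]) (by norm_num [cnull]) (Or.inr ⟨by norm_num, by norm_num⟩) (Or.inr (Or.inr (by norm_num))) (Or.inr rfl) (by norm_num) (by norm_num) (by norm_num) (by decide) (Or.inr (by norm_num))
      (Or.inr (tail_six_heavy_sq36Q_32 (p + 32) (by omega))) hR hn hfree (level_six_poly_heavy_sq36Q_32 p hp)
  · exact c025_core_six_heavy_cell_sq36q M p 33 24 1 1 39 0 1 2456 1000 39 9673 498
      (by norm_num) (by norm_num) (by norm_num) (by norm_num) (by norm_num) (by norm_num) (by norm_num)
      (by norm_num [cnull]) (by norm_num [cnull]) (Or.inr ⟨by norm_num, by norm_num⟩) (Or.inr (Or.inr (by norm_num))) (Or.inr rfl) (by norm_num) (by norm_num) (by norm_num) (by decide) (Or.inr (by norm_num))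
      (Or.inr (tail_six_heavy_sq36Q_33 (p + 33) (by omega))) hR hn hfree (level_six_poly_heavy_sq36Q_33 p hp)
  · exact c025_core_six_heavy_cell_sq36q M p 34 25 1 1 39 0 1 2204 1000 39 10557 530
      (by norm_num) (by norm_num) (by norm_num) (by norm_num) (by norm_num) (by norm_num) (by norm_num)
      (by norm_num [cnull]) (by norm_num [cnull]) (Or.inr ⟨by norm_num, by norm_num⟩) (Or.inr (Or.inr (by norm_num))) (Or.inr rfl) (by norm_num) (by norm_num) (by norm_num) (by decide) (Or.inr (by norm_num))
      (Or.inr (tail_six_heavy_sq36Q_34 (p + 34) (by omega))) hR hn hfree (level_six_poly_heavy_sq36Q_34 p hp)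
  · exact c025_core_six_heavy_cell_sq36q M p 35 25 1 1 39 0 1 1997 1000 39 11493 563
      (by norm_num) (by norm_num) (by norm_num) (by norm_num) (by norm_num) (by norm_num) (by norm_num)
      (by norm_num [cnull]) (by norm_num [cnull]) (Or.inr ⟨by norm_num, by norm_num⟩) (Or.inr (Or.inr (by norm_num))) (Or.inr rfl) (by norm_num) (by norm_num) (by norm_num) (by decide) (Or.inr (by norm_num))
      (Or.inr (tail_six_heavy_sq36Q_35 (p + 35) (by omega))) hR hn hfree (level_six_poly_heavy_sq36Q_35 p hp)
  · exact c025_core_six_heavy_cell_sq36q M p 36 26 1 1 39 0 1 1827 1000 39 12483 597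
      (by norm_num) (by norm_num) (by norm_num) (by norm_num) (by norm_num) (by norm_num) (by norm_num)
      (by norm_num [cnull]) (by norm_num [cnull]) (Or.inr ⟨by norm_num, by norm_num⟩) (Or.inr (Or.inr (by norm_num))) (Or.inr rfl) (by norm_num) (by norm_num) (by norm_num) (by decide) (Or.inr (by norm_num))
      (Or.inr (tail_six_heavy_sq36Q_36 (p + 36) (by omega))) hR hn hfree (level_six_poly_heavy_sq36Q_36 p hp)
  · exact c025_core_six_heavy_cell_sq36q M p 37 26 1 1 39 0 1 1687 1000 39 13528 632
      (by norm_num) (by norm_num) (by norm_num) (by norm_num) (by norm_num) (by norm_num) (by norm_num)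
      (by norm_num [cnull]) (by norm_num [cnull]) (Or.inr ⟨by norm_num, by norm_num⟩) (Or.inr (Or.inr (by norm_num))) (Or.inr rfl) (by norm_num) (by norm_num) (by norm_num) (by decide) (Or.inr (by norm_num))
      (Or.inr (tail_six_heavy_sq36Q_37 (p + 37) (by omega))) hR hn hfree (level_six_poly_heavy_sq36Q_37 p hp)
  · exact c025_core_six_heavy_cell_sq36q M p 38 27 1 1 39 0 1 1571 1000 39 14630 668
      (by norm_num) (by norm_num) (by norm_num) (by norm_num) (by norm_num) (by norm_num) (by norm_num)
      (by norm_num [cnull]) (by norm_num [cnull]) (Or.inr ⟨by norm_num, by norm_num⟩) (Or.inr (Or.inr (by norm_num))) (Or.inr rfl) (by norm_num) (by norm_num) (by norm_num) (by decide) (Or.inr (by norm_num))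
      (Or.inr (tail_six_heavy_sq36Q_38 (p + 38) (by omega))) hR hn hfree (level_six_poly_heavy_sq36Q_38 p hp)
  · exact c025_core_six_heavy_cell_sq36q M p 39 27 1 1 39 0 1 1475 1000 39 15790 705
      (by norm_num) (by norm_num) (by norm_num) (by norm_num) (by norm_num) (by norm_num) (by norm_num)
      (by norm_num [cnull]) (by norm_num [cnull]) (Or.inr ⟨by norm_num, by norm_num⟩) (Or.inr (Or.inr (by norm_num))) (Or.inr rfl) (by norm_num) (by norm_num) (by norm_num) (by decide) (Or.inr (by norm_num))
      (Or.inr (tail_six_heavy_sq36Q_39 (p + 39) (by omega))) hR hn hfree (level_six_poly_heavy_sq36Q_39 p hp)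
  · exact c025_core_six_heavy_cell_sq36q M p 40 28 1 1 39 0 1 1395 1000 39 17010 743
      (by norm_num) (by norm_num) (by norm_num) (by norm_num) (by norm_num) (by norm_num) (by norm_num)
      (by norm_num [cnull]) (by norm_num [cnull]) (Or.inr ⟨by norm_num, by norm_num⟩) (Or.inr (Or.inr (by norm_num))) (Or.inr rfl) (by norm_num) (by norm_num) (by norm_num) (by decide) (Or.inr (by norm_num))
      (Or.inr (tail_six_heavy_sq36Q_40 (p + 40) (by omega))) hR hn hfree (level_six_poly_heavy_sq36Q_40 p hp)
  · exact c025_core_six_heavy_cell_sq36q M p 41 28 1 1 39 0 1 1328 1000 39 18291 782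
      (by norm_num) (by norm_num) (by norm_num) (by norm_num) (by norm_num) (by norm_num) (by norm_num)
      (by norm_num [cnull]) (by norm_num [cnull]) (Or.inr ⟨by norm_num, by norm_num⟩) (Or.inr (Or.inr (by norm_num))) (Or.inr rfl) (by norm_num) (by norm_num) (by norm_num) (by decide) (Or.inr (by norm_num))
      (Or.inr (tail_six_heavy_sq36Q_41 (p + 41) (by omega))) hR hn hfree (level_six_poly_heavy_sq36Q_41 p hp)
  · exact c025_core_six_heavy_cell_sq36q M p 42 29 1 1 39 0 1 1272 1000 39 19635 822
      (by norm_num) (by norm_num) (by norm_num) (by norm_num) (by norm_num) (by norm_num) (by norm_num)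
      (by norm_num [cnull]) (by norm_num [cnull]) (Or.inr ⟨by norm_num, by norm_num⟩) (Or.inr (Or.inr (by norm_num))) (Or.inr rfl) (by norm_num) (by norm_num) (by norm_num) (by decide) (Or.inr (by norm_num))
      (Or.inr (tail_six_heavy_sq36Q_42 (p + 42) (by omega))) hR hn hfree (level_six_poly_heavy_sq36Q_42 p hp)
  · exact c025_core_six_heavy_cell_sq36q M p 43 29 1 1 39 0 1 1225 1000 39 21043 863
      (by norm_num) (by norm_num) (by norm_num) (by norm_num) (by norm_num) (by norm_num) (by norm_num)
      (by norm_num [cnull]) (by norm_num [cnull]) (Or.inr ⟨by norm_num, by norm_num⟩) (Or.inr (Or.inr (by norm_num))) (Or.inr rfl) (by norm_num) (by norm_num) (by norm_num) (by decide) (Or.inr (by norm_num))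
      (Or.inr (tail_six_heavy_sq36Q_43 (p + 43) (by omega))) hR hn hfree (level_six_poly_heavy_sq36Q_43 p hp)
  · exact c025_core_six_heavy_cell_sq36q M p 44 30 1 1 39 0 1 1186 1000 39 22517 905
      (by norm_num) (by norm_num) (by norm_num) (by norm_num) (by norm_num) (by norm_num) (by norm_num)
      (by norm_num [cnull]) (by norm_num [cnull]) (Or.inr ⟨by norm_num, by norm_num⟩) (Or.inr (Or.inr (by norm_num))) (Or.inr rfl) (by norm_num) (by norm_num) (by norm_num) (by decide) (Or.inr (by norm_num))
      (Or.inr (tail_six_heavy_sq36Q_44 (p + 44) (by omega))) hR hn hfree (level_six_poly_heavy_sq36Q_44 p hp)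
  · exact c025_core_six_heavy_cell_sq36q M p 45 30 1 1 39 0 1 1153 1000 39 24058 948
      (by norm_num) (by norm_num) (by norm_num) (by norm_num) (by norm_num) (by norm_num) (by norm_num)
      (by norm_num [cnull]) (by norm_num [cnull]) (Or.inr ⟨by norm_num, by norm_num⟩) (Or.inr (Or.inr (by norm_num))) (Or.inr rfl) (by norm_num) (by norm_num) (by norm_num) (by decide) (Or.inr (by norm_num))
      (Or.inr (tail_six_heavy_sq36Q_45 (p + 45) (by omega))) hR hn hfree (level_six_poly_heavy_sq36Q_45 p hp)
  · exact c025_core_six_heavy_cell_sq36q M p 46 31 1 1 39 0 1 1126 1000 39 25668 992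
      (by norm_num) (by norm_num) (by norm_num) (by norm_num) (by norm_num) (by norm_num) (by norm_num)
      (by norm_num [cnull]) (by norm_num [cnull]) (Or.inr ⟨by norm_num, by norm_num⟩) (Or.inr (Or.inr (by norm_num))) (Or.inr rfl) (by norm_num) (by norm_num) (by norm_num) (by decide) (Or.inr (by norm_num))
      (Or.inr (tail_six_heavy_sq36Q_46 (p + 46) (by omega))) hR hn hfree (level_six_poly_heavy_sq36Q_46 p hp)
  · exact c025_core_six_heavy_cell_sq36q M p 47 31 1 1 39 0 1 1103 1000 39 27348 1037
      (by norm_num) (by norm_num) (by norm_num) (by norm_num) (by norm_num) (by norm_num) (by norm_num)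
      (by norm_num [cnull]) (by norm_num [cnull]) (Or.inr ⟨by norm_num, by norm_num⟩) (Or.inr (Or.inr (by norm_num))) (Or.inr rfl) (by norm_num) (by norm_num) (by norm_num) (by decide) (Or.inr (by norm_num))
      (Or.inr (tail_six_heavy_sq36Q_47 (p + 47) (by omega))) hR hn hfree (level_six_poly_heavy_sq36Q_47 p hp)
  · exact c025_core_six_heavy_cell_sq36q M p 48 32 1 1 39 0 1 1084 1000 39 29100 1083
      (by norm_num) (by norm_num) (by norm_num) (by norm_num) (by norm_num) (by norm_num) (by norm_num)
      (by norm_num [cnull]) (by norm_num [cnull]) (Or.inr ⟨by norm_num, by norm_num⟩) (Or.inr (Or.inr (by norm_num))) (Or.inr rfl) (by norm_num) (by norm_num) (by norm_num) (by decide) (Or.inr (by norm_num))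
      (Or.inr (tail_six_heavy_sq36Q_48 (p + 48) (by omega))) hR hn hfree (level_six_poly_heavy_sq36Q_48 p hp)
  · exact c025_core_six_heavy_cell_sq36q M p 49 32 1 1 39 0 1 1068 1000 39 30925 1130
      (by norm_num) (by norm_num) (by norm_num) (by norm_num) (by norm_num) (by norm_num) (by norm_num)
      (by norm_num [cnull]) (by norm_num [cnull]) (Or.inr ⟨by norm_num, by norm_num⟩) (Or.inr (Or.inr (by norm_num))) (Or.inr rfl) (by norm_num) (by norm_num) (by norm_num) (by decide) (Or.inr (by norm_num))
      (Or.inr (tail_six_heavy_sq36Q_49 (p + 49) (by omega))) hR hn hfree (level_six_poly_heavy_sq36Q_49 p hp)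
  · exact c025_core_six_heavy_cell_sq36q M p 50 33 1 1 39 0 1 1055 1000 39 32825 1178
      (by norm_num) (by norm_num) (by norm_num) (by norm_num) (by norm_num) (by norm_num) (by norm_num)
      (by norm_num [cnull]) (by norm_num [cnull]) (Or.inr ⟨by norm_num, by norm_num⟩) (Or.inr (Or.inr (by norm_num))) (Or.inr rfl) (by norm_num) (by norm_num) (by norm_num) (by decide) (Or.inr (by norm_num))
      (Or.inr (tail_six_heavy_sq36Q_50 (p + 50) (by omega))) hR hn hfree (level_six_poly_heavy_sq36Q_50 p hp)
  · exact c025_core_six_heavy_cell_sq36q M p 51 33 1 1 39 0 1 1044 1000 39 34801 1227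
      (by norm_num) (by norm_num) (by norm_num) (by norm_num) (by norm_num) (by norm_num) (by norm_num)
      (by norm_num [cnull]) (by norm_num [cnull]) (Or.inr ⟨by norm_num, by norm_num⟩) (Or.inr (Or.inr (by norm_num))) (Or.inr rfl) (by norm_num) (by norm_num) (by norm_num) (by decide) (Or.inr (by norm_num))
      (Or.inr (tail_six_heavy_sq36Q_51 (p + 51) (by omega))) hR hn hfree (level_six_poly_heavy_sq36Q_51 p hp)

/-- **THEOREM C₆ ON THE FLAT BOUNDS `39 / 19`, LEMMA Q / T⁺⁺⁺, THE 4-CIRCUIT TABLE, THE FLAT-COUNT TAIL AND THE UNIQUE HEAVY FLAT, GIVEN LEVEL `5`**: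
level `5` for all `p ≥ 35` implies level `6` for all `p ≥ 36`. -/
theorem c025_six_of_five_heavy_sq36q (h5 : ∀ (M : Matroid α) [M.Finite] (p : ℕ), 35 ≤ p → RLS M p 5) :
    ∀ (M : Matroid α) [M.Finite] (p : ℕ), 36 ≤ p → RLS M p 6 := by
  intro M _ p hp
  rcases Nat.lt_or_ge p 37 with hlt | hge
  · have hP : p = 36 := by omega
    subst hP
    refine rls_six_at_of_core 36 (by norm_num) (fun M _ => h5 M 35 (by norm_num)) ?_ M
    intro M _ d hd hR hn hfree
    rcases Nat.lt_or_ge d 52 with hd51 | hd52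
    · exact c025_core_six_bounded_corank_heavy_sq36q M 36 d (by norm_num) hd (by omega) hR hn hfree
    · exact c025_core_six_thirtynine_thirtysix' M 36 (by norm_num) hR (by omega) hfree
  · refine rls_succ_large (α := α) 5 6 36 ?_ ?_ ?_ M p hge (by omega)
    · intro M' _ p' hP _
      exact h5 M' p' (by omega)
    · intro M' _ p' _ hn _
      rcases Nat.lt_or_ge M'.E.ncard (p' + 6) with h | h
      · exact RLS_of_ncard_lt M' h
      · exact RLS_of_ncard_eq M' (by omega)
    · intro M' _ p' hP hR hbig _ hfree
      rcases Nat.lt_or_ge M'.E.ncard (p' + 52) with h | h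
      · exact c025_core_six_bounded_corank_heavy_sq36q M' p' (M'.E.ncard - p') hP (by omega) (by omega) hR (by omega) hfree
      · exact c025_core_six_thirtynine_thirtysix' M' p' (by omega) hR (by omega) hfree

/-- **C-025 AT LEVEL `6` FOR EVERY `p ≥ 36`, EVERY FINITE MATROID, UNCONDITIONAL** — `c025_six_of_five_heavy_sq36q` on
p7's level-`5` row `c025_five_large_part33 (33 ≤ p)`. -/
theorem c025_six_large_thirty_six (M : Matroid α) [M.Finite] (p : ℕ) (hp : 36 ≤ p) : RLS M p 6 :=
  c025_six_of_five_heavy_sq36q (fun M _ p hp => c025_five_large_part33 M p (by omega)) M p hp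

/-- The same in the vocabulary of `C025`: the level-`6` frontier of the counting route is every `p ≥ 36`. -/
theorem c025_six_large_thirty_six' (M : Matroid α) [M.Finite] (p : ℕ) (hp : 36 ≤ p) :
    phiK p 6 * ({A : Set α | A ⊆ M.E ∧ M.eRk A = (p : ℕ∞) ∧ M.eRk (M.E \ A) = (6 : ℕ∞)}.ncard : ℚ) ≤
      ({A : Set α | A ⊆ M.E ∧ (6 : ℕ∞) < M.eRk A ∧ M.eRk A < (p : ℕ∞)}.ncard : ℚ) :=
  c025_six_large_thirty_six M p hp

end ThmN

end PercRepro
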